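import Summits.CriticalPhenomena.PercolationContinuityZ3.Theorems.Transplant.SkelPhiNegReachHabResG
import Summits.CriticalPhenomena.PercolationContinuityZ3.Theorems.Transplant.SkelPhiNegReachRooms
import HarnessLib

/-!
# N1 (the `{±1}` node), (C) column file (C-A1): THE CORRIDOR RESIDUE OF THE N1 SCHEME OF RECORD `cellGeomSG₂` FROM TWO SCHEDULES WITH PLANAR /
# FOOTPRINT-LEVEL ROOMS — `Skelφ.reachOblAtHN_of_chain₂` (scheme-generic, p279103) instantiated at hp-8's `cellGeomSG₂ G F P w₀ Λ` (cell map `F`,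
# slack far region, weak steps) with its four vertex-level readings DISCHARGED by the rooms of `SkelPhiNegReachRooms` (C-R): what remains are
# (i) the PLANAR rooms of segment 1 (read through the cell map `F` itself: `P.M y ⊆ core 0`, `region k ⊆ P.Q y ∪ P.Hfull y du`), (ii) the cross link,
# (iii) the FOOTPRINT-level rooms of segment 2 (read through any 1-Lipschitz `R`, e.g. p1's run frame: `R v ∈ region k ⇒ F v ∈ P.Q y ∪ P.Hfull y du`;
# `R v ∈ last core ⇒ F v ∈ P.Hfull y du ∧ (F v ± 1) ⊆ P.M (y+du)`), (iv) the depth room `Λ.ρ a' y du ℓ + 1 ≤ Λ.rM a' (y+du)`, and the chain /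
# analytic inputs verbatim.

builds on p205010 (kernel theorem, internal audit signed; external expert review pending) — nothing in this file uses p205010; nothing here is a
claim about the open node `SamePDropOfSkeletonNeg`.
Lane `prim-bschramm`, seat `prim-bschramm-p5` (gen 8; (C) lineage); helper file (`--supports stmt-CriticalPhenomena-4575`).

* **`Skelφ.reachOblAtHN_of_schedules₂SG₂`**.
[cite: KozmaNitzan2024, §4 Lemma 12 (pp. 23–25), p. 26 (M_x, H_{v,x}), p. 30 (Step IV), p. 31]
-/

noncomputable section

open MeasureTheory ProbabilityTheory
open scoped ENNReal Classical

namespace Summit.CriticalPhenomena.PercolationContinuityZ3.Theorems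

namespace Transplant

namespace Skelφ

open Literature.Probability.Percolation Literature.Probability.LatticeModels SimpleGraph GadgetSystem ProbeHistory HSiteScheme Contour KNCells
open KNCells.KSchA KNLevels ChainPlanar
open BoxProdZ2 (ConcRadiiG)
open Skel (ReachOblAtHN)

variable {V : Type} [DecidableEq V] {G : SimpleGraph V} [G.LocallyFinite] {F R : V → Site 2}

/-- **THE CORRIDOR RESIDUE OF THE N1 SCHEME OF RECORD FROM TWO SCHEDULES.**  `S = ⟨cellGeomSG₂ G F P w₀ Λ, q, δc⟩`, `FD = faceDataSG G F P w₀ Λ`;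
segment 1 read through the cell map `F` with PLANAR rooms, segment 2 through `R` with FOOTPRINT rooms; `du ≠ rev e.2`; the depth room of the last
cube; chain data, nonempty true targets, counts, kits, rim excess as in `reachOblAtHN_of_chain₂` ⟹ `Skel.ReachOblAtHN G nmax S FD Δ' δ h e a' du`.
[cite: KozmaNitzan2024, §4 Lemma 12 (pp. 23–25), p. 30 (Step IV), p. 31] -/
theorem reachOblAtHN_of_schedules₂SG₂ (hlipF : Lip G F) (hlipR : Lip G R) {P : PCells2} {w₀ : V} {Λ : ConcRadiiG} {q : unitInterval} {δc : ℝ}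
    (S : KSchA V ℕ) (hS : S = ⟨cellGeomSG₂ G F P w₀ Λ, q, δc⟩) (FD : FaceData V ℕ) (hFD : FD = faceDataSG G F P w₀ Λ) {LD : LevelData V ℕ}
    (hL : LevelGeom G S.Γ FD LD) (hQ : QSepGeom G S.Γ) (hSt : StepsGeom S.Γ FD) (hEx : ExitGeom G S.Γ)
    {h : ProbeHistory V} {e : Site 2 × MDir} (hV : S.Valid₂ G h e) {a' : ℕ} (ha' : a' ∈ S.Γ.anchSet (S.aOf₁ G h e) (tgt e))
    {du : MDir} (hdu : du ∈ S.onward G h (tgt e)) (hdur : du ≠ rev e.2) {nmax : ℕ}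
    (Ω : Finset V) (hΩ : Ω = S.Γ.Ewv (S.aOf₁ G h e) e.1 e.2 ∪ FD.Hfull a' (tgt e) du)
    -- segment 1 over the cell map `F`: planar rooms
    (S₁ S₂ : SchedFrame)
    (hM0 : P.M (tgt e) ⊆ S₁.core 0)
    (hreg₁ : ∀ k ≤ S₁.N, S₁.region k ⊆ P.Q (tgt e) ∪ P.Hfull (tgt e) du)
    -- the cross link; segment 2 over `R`: footprint rooms
    (hx : WinIn F Ω (S₁.core (S₁.N + 1)) ⊆ WinIn R Ω (S₂.core 0))
    (hreg₂ : ∀ k ≤ S₂.N, ∀ v ∈ Ω, R v ∈ S₂.region k → F v ∈ P.Q (tgt e) ∪ P.Hfull (tgt e) du)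
    (hlast₂ : ∀ v ∈ Ω, R v ∈ S₂.core (S₂.N + 1) → F v ∈ P.Hfull (tgt e) du ∧ Finset.Icc (F v - 1) (F v + 1) ⊆ P.M (tgt e + stepVec du))
    -- depth room of the last cube
    (hρM : ∀ ℓ, Λ.ρ a' (tgt e) du ℓ + 1 ≤ Λ.rM a' (tgt e + stepVec du))
    (hn : S₁.N + 1 + S₂.N ≤ nmax)
    -- chain data
    (P₁ P₂ : WinChainData V) (hPo₁ : P₁.o = S.Γ.root) (hPo₂ : P₂.o = S.Γ.root)
    (hPS₁ : P₁.Sfin = S.Sx G h e (S.aOf₁ G h e) a' du) (hPS₂ : P₂.Sfin = S.Sx G h e (S.aOf₁ G h e) a' du)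
    (hRim₁ : ∀ k, P₁.Rim k ⊆ (planarWindowIn hlipF Ω).stepDF S₁ k) (hRim₂ : ∀ k, P₂.Rim k ⊆ (planarWindowIn hlipR Ω).stepDF S₂ k)
    (hRl₁ : P₁.Rlev + 1 ≤ S₁.R') (hRl₂ : P₂.Rlev + 1 ≤ S₂.R') (hj₁ : P₁.j₁ ≤ P₁.Rlev) (hj₂ : P₂.j₁ ≤ P₂.Rlev)
    (hTne₁ : ∀ k ≤ S₁.N, ((planarWindowIn hlipF Ω).coreTF S₁ k).Nonempty) (hTne₂ : ∀ k ≤ S₂.N, ((planarWindowIn hlipR Ω).coreTF S₂ k).Nonempty)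
    -- analytic inputs
    {Δ' : ℕ} {δ η : ℝ}
    (hcount₁ : 1 / (1 - (S.p : ℝ)) ^ (Δ' * P₁.N) ≤ δ * ((Finset.Icc P₁.j₀ P₁.j₁).card : ℝ))
    (hcount₂ : 1 / (1 - (S.p : ℝ)) ^ (Δ' * P₂.N) ≤ δ * ((Finset.Icc P₂.j₀ P₂.j₁).card : ℝ))
    (hkits₁ : ∀ k ≤ S₁.N, ∀ j ∈ Finset.Icc P₁.j₀ P₁.j₁, ∃ (σ : SData V) (Sz : Finset V),
      SHyp (P₁.stepLF (planarWindowIn hlipF Ω) S₁ k) j σ ∧ σ.N ≤ P₁.N ∧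
      (1 - (S.p : ℝ) ^ σ.sB) ^ σ.k ≤ δ ∧ Sz ⊆ (P₁.stepLF (planarWindowIn hlipF Ω) S₁ k).X j ∧ Sz ⊆ (planarWindowIn hlipF Ω).stepDF S₁ k ∧
      (∀ x ∈ σ.K, ∀ e' ∈ σ.seed x, e' ∉ wireSet (↑Sz : Set V)) ∧ (∀ x ∈ σ.K, σ.face x ⊆ Sz) ∧
      (∀ x ∈ σ.K, 1 - 3 * δ ≤ (prodBernoulli (S.Wcor G FD h e (S.aOf₁ G h e) a' du)).real {ω | ∃ u ∈ σ.face x,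
        1 - δ < (prodBernoulli (pinW (S.Wcor G FD h e (S.aOf₁ G h e) a' du) (wireSet (↑Sz : Set V)) ω)).real
          (⋃ t' ∈ P₁.coreEF (planarWindowIn hlipF Ω) S₁ k, openConnIn (↑((planarWindowIn hlipF Ω).stepDF S₁ k) : Set V) u t')}))
    (hkits₂ : ∀ k ≤ S₂.N, ∀ j ∈ Finset.Icc P₂.j₀ P₂.j₁, ∃ (σ : SData V) (Sz : Finset V),
      SHyp (P₂.stepLF (planarWindowIn hlipR Ω) S₂ k) j σ ∧ σ.N ≤ P₂.N ∧
      (1 - (S.p : ℝ) ^ σ.sB) ^ σ.k ≤ δ ∧ Sz ⊆ (P₂.stepLF (planarWindowIn hlipR Ω) S₂ k).X j ∧ Sz ⊆ (planarWindowIn hlipR Ω).stepDF S₂ k ∧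
      (∀ x ∈ σ.K, ∀ e' ∈ σ.seed x, e' ∉ wireSet (↑Sz : Set V)) ∧ (∀ x ∈ σ.K, σ.face x ⊆ Sz) ∧
      (∀ x ∈ σ.K, 1 - 3 * δ ≤ (prodBernoulli (S.Wcor G FD h e (S.aOf₁ G h e) a' du)).real {ω | ∃ u ∈ σ.face x,
        1 - δ < (prodBernoulli (pinW (S.Wcor G FD h e (S.aOf₁ G h e) a' du) (wireSet (↑Sz : Set V)) ω)).real
          (⋃ t' ∈ P₂.coreEF (planarWindowIn hlipR Ω) S₂ k, openConnIn (↑((planarWindowIn hlipR Ω).stepDF S₂ k) : Set V) u t')}))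
    (hη : η ≤ δ / 2)
    (hexc₁ : ∀ k ≤ S₁.N, (prodBernoulli (S.Wcor G FD h e (S.aOf₁ G h e) a' du)).real (⋃ t' ∈ P₁.Rim k, openConn S.Γ.root t') ≤ η)
    (hexc₂ : ∀ k ≤ S₂.N, (prodBernoulli (S.Wcor G FD h e (S.aOf₁ G h e) a' du)).real (⋃ t' ∈ P₂.Rim k, openConn S.Γ.root t') ≤ η) :
    ReachOblAtHN G nmax S FD Δ' δ h e a' du := by
  subst hS hFD
  refine reachOblAtHN_of_chain₂ hlipF hlipR hL hQ hSt hEx hV ha' hdu Ω hΩ S₁ S₂ ?_ ?_ hx ?_ ?_ hn P₁ P₂ hPo₁ hPo₂ hPS₁ hPS₂ hRim₁ hRim₂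
    hRl₁ hRl₂ hj₁ hj₂ hTne₁ hTne₂ hcount₁ hcount₂ hkits₁ hkits₂ hη hexc₁ hexc₂
  · intro v hv; exact hM0 (footprint_mem_of_mem_M₂ hv)
  · intro k hk v hvΩ hvF; rw [hΩ] at hvΩ; exact mem_Q_union_Efar_of_mem_habΩ₂ hSt ha' hdur hvΩ (hreg₁ k hk hvF)
  · intro k hk v hvΩ hvR; have hvΩ' := hvΩ; rw [hΩ] at hvΩ'; exact mem_Q_union_Efar_of_mem_habΩ₂ hSt ha' hdur hvΩ' (hreg₂ k hk v hvΩ hvR)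
  · intro v hvΩ hvR
    obtain ⟨hH, hbox⟩ := hlast₂ v hvΩ hvR
    rw [hΩ] at hvΩ
    exact mem_M_of_mem_habΩ₂ hlipF hdur hρM hvΩ hH hbox

end Skelφ

end Transplant

end Summit.CriticalPhenomena.PercolationContinuityZ3.Theorems

end
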